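import Summits.BirchSwinnertonDyer.BirchSwinnertonDyer.Theorems.PrintX9ResplitClosersCoherentPair
import HarnessLib

set_option linter.dupNamespace false -- nested cell layout (D-0017)
set_option autoImplicit false

/-!
# PrintX9 — the H161 entry glue `HowardContainmentLightFramePinnedOfPrintSharpOfHowardMu` holds (plan g12 turnkey)

Closes the route item `Summit.BirchSwinnertonDyer.BirchSwinnertonDyer.Theses.PrintX9.HowardContainmentLightFramePinnedOfPrintSharpOfHowardMu`
(`MuInequalityCoherentPairOfHoward → HowardDVRKolyvaginBound → HowardContainmentLightFramePinnedOfPrintSharp`) AT ONCE: modus ponens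
into the landed chain 27077 ⟸ 22642 (p650959, `PrintX9Resplit.howardContainmentLightFramePinnedOfPrintSharp_of_muInequalityCoherentPair`;
the new crux's conclusion is item 22642's letter verbatim, `Iff.rfl`).  THEOREMS ONLY; no definition, no named fact, no `sorry`.
Propose: `ledger propose --kind proof --target Summits/BirchSwinnertonDyer/BirchSwinnertonDyer/Theorems/PrintX9HowardMuEntry.lean
--file PrintX9HowardMuEntry.lean --workitem <item id of HowardContainmentLightFramePinnedOfPrintSharpOfHowardMu>`.
Honest framing: bookkeeping; Howard 2004 Thm. 1.6.1 stays a HYPOTHESIS (cite-only); no crux of substance is proved; BSD is NOT proved by this.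
[cite: Howard2004HeegnerKolyvagin, Thm. 1.6.1] [cite: MastellaZerman2026, Cor. 4.6] [cite: CastellaGrossiLeeSkinner2022, Thm. 4.1.1]
[cite: CastellaGrossiSkinner2025, Thm. 6.5.2]
-/

namespace Summit.BirchSwinnertonDyer.BirchSwinnertonDyer.Theorems.PrintX9HowardMuEntry

open Summit.BirchSwinnertonDyer.BirchSwinnertonDyer.Theses.PrintX9

/-- **The H161 entry glue of PrintX9 holds** (one line over p650959). [cite: Howard2004HeegnerKolyvagin, Thm. 1.6.1] -/
theorem howardContainmentLightFramePinnedOfPrintSharpOfHowardMu_holds :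
    HowardContainmentLightFramePinnedOfPrintSharpOfHowardMu :=
  fun hM hH =>
    Summit.BirchSwinnertonDyer.BirchSwinnertonDyer.Theorems.PrintX9Resplit.howardContainmentLightFramePinnedOfPrintSharp_of_muInequalityCoherentPair
      (hM hH)

end Summit.BirchSwinnertonDyer.BirchSwinnertonDyer.Theorems.PrintX9HowardMuEntry
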